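import Mathlib.CategoryTheory.SingleObj
import Literature.AnabelianGeometry.EtaleTheta.TemperedFrobenioidToy
import Literature.AnabelianGeometry.EtaleTheta.TemperedFrobenioidModel
import HarnessLib

/-!
# [EtTh] Def. 3.6 AS TYPED admits a tempered Frobenioid whose divisor monoid is DILATED by the base
# (toy data over the one-object base `SingleObj ℕ_{≥1}`, part 1: the data and its model category)

S. Mochizuki, *The étale theta function and its Frobenioid-theoretic manifestations*, Publ. RIMS **45** (2009)
[EtTh], Def. 3.6 (i)–(ii) PDF pp. 76–77 [cite: MochizukiEtTh2009, Def 3.6 p.77]; S. Mochizuki, *The geometry of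
Frobenioids I*, Kyushu J. Math. **62** (2008) [FrdI], Def. 1.1 (i) p. 19 ("non-dilating"), Thm. 5.2 (i) p. 100 (the model
Frobenioid) [cite: MochizukiFrdI2008, Thm. 5.2(i) p.100].  abc-iut cell, block F (fact-proving wave), seat abc-iut-f-142
(gen 3); DATA file behind the NV/tightness certificate `TemperedFrobenioidCor38SubDilationNegative.lean` for the Cor. 3.8
operations-only rows (FACT-LIST F-2815 `Cor38Hyp.PreservesLinear`; F-2809, F-2812 for contrast).  Pattern of abc-iut-L2-t3's
`TemperedFrobenioidToy.lean` and abc-iut-f-135's `TemperedFrobenioidUnitToy.lean`, one notch richer: a NON-TRIVIAL base.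

WHAT IS BUILT (`DilSwap.…`), over the trivial [FrdI] vocabularies (`Toy.monoidVocab`, `DilSwap.catVocab`): the base
`D = D₀ = SingleObj ℕ_{≥1}` (one object `•`, `End(•) = (ℕ_{≥1}, ·)`; connected, totally epimorphic), the divisor monoid
`Φ₀ = Φ₀^ℝ = Φ = Φ^{ℝ-log} : • ↦ ℚ_{≥0}` on which the arrow of exponent `n` pulls back by the CONTRACTION `z ↦ z/n`
(`Φfun`; a DILATING monoid — admissible because the typed interface carries [FrdI] Def. 1.1 (i) "non-dilating" only as the
free clause `V.IsNonDilating`), `B₀ = B₀^Λ = (ℚ_{≥0})^gp` with `Div = id`, `F₀ = F₀^Λ = B₀`, `ℝ·Φ₀^cnst =` everything, so that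
`Φ^{bs-fld} = ℚ_{≥0}` is `ℚ`-monoprime (REAL `IsMonoprime`) and Def. 3.6 (ii)(b) holds (REAL): `DilSwap.realified`,
`DilSwap.C : TemperedFrobenioid realified (SingleObj ℕ+) catVocab`.  Then the bookkeeping of its model category
([FrdI] Thm. 5.2 (i)): an arrow `(A, α) → (B, β)` is `(deg_Fr d, Base = exponent n, Div z ∈ ℚ_{≥0}, u)` with `u ∈ B`
DETERMINED by the relation (every Hom-set is `ℕ_{≥1} × ℕ_{≥1} × ℚ_{≥0}`), and `Div(φ ≫ ψ) = Div(ψ)/n_φ + deg(ψ)·Div(φ)`;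
the rescaling `sdiv n e z = (e/n)·z` with its cocycle identity `sdiv_comp` (the algebra that makes the degree↔dilation
swap of part 2 a functor); the isometric rational functions `swapUnit`.
HONEST FRAMING: a degenerate inhabitant of the TYPED interface, not a tempered Frobenioid of a curve (print's `Φ` is
non-dilating and print's base is of FSMFF-type — this base is NOT, see part 3); it says nothing about [EtTh] itself;
nothing here bears on [IUTchIII] Cor. 3.12; no side taken; typed ≠ proved.
-/

noncomputable section

namespace Literature.AnabelianGeometry.EtaleTheta

open CategoryTheory Opposite Literature.AlgebraicGeometry.Frobenioids

namespace DilSwap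

/-! ## §1 The value monoid `ℚ≥0`, its scalings, and the contracting base `SingleObj ℕ≥1` -/

/-- `Φ^{ℝ-log}(•) = ℚ_{≥0}` (additive monoid, written multiplicatively). [cite: MochizukiEtTh2009, Def 3.6 p.76] -/
abbrev M : Type := Multiplicative ℚ≥0

/-- Scaling `z ↦ c·z` of `ℚ_{≥0}`, a monoid endomorphism. [cite: MochizukiEtTh2009, Def 3.6 p.76] -/
def scale (c : ℚ≥0) : M →* M := (AddMonoidHom.mulLeft c).toMultiplicative

/-- Value of `scale`. [cite: MochizukiEtTh2009, Def 3.6 p.76] -/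
@[simp] theorem scale_apply (c : ℚ≥0) (x : M) :
    scale c x = Multiplicative.ofAdd (c * Multiplicative.toAdd x) := rfl

/-- `scale 1 = id`. [cite: MochizukiEtTh2009, Def 3.6 p.76] -/
theorem scale_one : scale 1 = MonoidHom.id M := by
  ext x; simp

/-- `scale (ab) = scale a ∘ scale b`. [cite: MochizukiEtTh2009, Def 3.6 p.76] -/
theorem scale_mul (a b : ℚ≥0) : scale (a * b) = (scale a).comp (scale b) := by
  ext x; simp [mul_assoc]

/-- The exponent `n ∈ ℕ_{≥1}` of an arrow of the one-object base `SingleObj ℕ_{≥1}` (bookkeeping coercion).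
[cite: MochizukiEtTh2009, Def 3.6 p.76] -/
def expo {A B : SingleObj ℕ+} (f : A ⟶ B) : ℕ+ := f

/-- `expo id = 1`. [cite: MochizukiEtTh2009, Def 3.6 p.76] -/
@[simp] theorem expo_id (A : SingleObj ℕ+) : expo (𝟙 A) = 1 := rfl

/-- `expo (f ≫ g) = expo g · expo f`. [cite: MochizukiEtTh2009, Def 3.6 p.76] -/
@[simp] theorem expo_comp {A B C : SingleObj ℕ+} (f : A ⟶ B) (g : B ⟶ C) :
    expo (f ≫ g) = expo g * expo f := rfl

/-- **The DILATING divisor monoid on the base**: `Φ₀ = Φ₀^ℝ : (SingleObj ℕ_{≥1})ᵒᵖ → 𝔐𝔬𝔫`, `• ↦ ℚ_{≥0}`, the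
arrow of exponent `n` pulling back by the CONTRACTION `z ↦ z/n`.  Admissible for the typed Def. 3.6 data because
"non-dilating" is carried only by the free vocabulary clause `V.IsNonDilating`. [cite: MochizukiEtTh2009, Def 3.6 p.76] -/
def Φfun : (SingleObj ℕ+)ᵒᵖ ⥤ CommMonCat.{0} where
  obj _ := CommMonCat.of M
  map f := CommMonCat.ofHom (scale ((expo f.unop : ℕ+) : ℚ≥0)⁻¹)
  map_id A := by
    apply CommMonCat.hom_ext
    rw [CommMonCat.hom_ofHom, CommMonCat.hom_id]
    change scale (((1 : ℕ+) : ℚ≥0))⁻¹ = _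
    rw [PNat.one_coe, Nat.cast_one, inv_one, scale_one]
  map_comp f g := by
    apply CommMonCat.hom_ext
    rw [CommMonCat.hom_ofHom, CommMonCat.hom_comp, CommMonCat.hom_ofHom, CommMonCat.hom_ofHom]
    change scale ((expo f.unop * expo g.unop : ℕ+) : ℚ≥0)⁻¹ = _
    rw [PNat.mul_coe, Nat.cast_mul, mul_inv, mul_comm, scale_mul]

/-- Value of the pull-back of `Φfun`. [cite: MochizukiEtTh2009, Def 3.6 p.76] -/
@[simp] theorem Φfun_map_apply {A B : (SingleObj ℕ+)ᵒᵖ} (f : A ⟶ B) (x : M) :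
    (Φfun.map f).hom x = scale ((expo f.unop : ℕ+) : ℚ≥0)⁻¹ x := rfl

/-- The trivial [FrdI] category vocabulary on `SingleObj ℕ_{≥1}`. [cite: MochizukiEtTh2009, Def 3.6 p.77] -/
def catVocab : FrdICatStub.{0, 0, 0} (SingleObj ℕ+) where
  IsDivisorialOn _ := True
  IsRational _ := True
  IsStrictlyRational _ := True

/-! ## §2 Def. 3.3 (iii) / 3.6 (i) data: `Φ₀ = Φ₀^ℝ = ℚ≥0` (dilating), `B₀ = B₀^Λ = (ℚ≥0)^gp`, `Div = id`,
everything constant and non-cuspidal, `ℝ·Φ₀^cnst =` everything -/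

/-- Def. 3.3 (iii) data over the contracting base. [cite: MochizukiEtTh2009, Def 3.3 p.73] -/
def divisorMonoids : DivisorMonoids.{0, 0, 0} (SingleObj ℕ+) where
  Φ₀ := Φfun
  B₀ := monoidGp Φfun
  isUnit_B₀ _ b := by
    change IsUnit (M := Algebra.GrothendieckGroup M) b
    exact Group.isUnit _
  div₀ _ := MonoidHom.id _
  div₀_natural _ _ := rfl
  F₀ _ := ⊤
  F₀_map _ _ _ := trivial
  ncsp₀ _ := ⊤
  csp₀ _ := ⊥
  ncsp₀_map _ _ _ := trivial
  csp₀_map _ x hx := by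
    rw [Submonoid.mem_bot] at hx ⊢
    rw [hx, map_one]
  existsUnique_ncsp_csp _ x := by
    refine ⟨(⟨x, trivial⟩, ⟨1, Submonoid.mem_bot.mpr rfl⟩), mul_one x, ?_⟩
    rintro ⟨a, c⟩ h
    have hc : c.1 = 1 := Submonoid.mem_bot.mp c.2
    have ha : a.1 = x := by
      have h' : a.1 * c.1 = x := h
      rwa [hc, mul_one] at h'
    exact Prod.ext (Subtype.ext ha) (Subtype.ext hc)

/-- Def. 3.6 (i) data over the contracting base (`Λ = ℚ`, `Φ₀^ℝ = Φ₀`, `B₀^Λ = B₀ = (ℚ≥0)^gp`, `Div = id`,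
`F₀^Λ = B₀^Λ`, `ℝ·Φ₀^cnst =` all of `(Φ₀^ℝ)^gp`), over the trivial monoid vocabulary `Toy.monoidVocab`.
[cite: MochizukiEtTh2009, Def 3.6 p.76] -/
def realified : RealifiedDivisorMonoids (D₀ := SingleObj ℕ+) Toy.monoidVocab where
  toDivisorMonoids := divisorMonoids
  Λ := MonoidType.Q
  ΦR := Φfun
  toR _ := MonoidHom.id _
  toR_natural _ _ := rfl
  isRealification _ := trivial
  BΛ := monoidGp Φfun
  isUnit_BΛ _ b := by
    change IsUnit (M := Algebra.GrothendieckGroup M) b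
    exact Group.isUnit _
  divΛ _ := MonoidHom.id _
  divΛ_natural _ _ := rfl
  FΛ _ := ⊤
  FΛ_map _ _ _ := trivial
  cnstR _ := ⊤
  cnstR_map _ _ _ := trivial
  divΛ_mem_cnstR _ _ _ := trivial
  cnstR_root _ _ _ _ := trivial
  cnst_le_cnstR _ _ _ := trivial
  ncspR _ := ⊤
  cspR _ := ⊥
  toR_ncsp _ _ _ := trivial
  toR_csp _ _ hx := hx

/-- A submonoid of `ℚ_{≥0}` which is everything is `ℚ`-monoprime. [cite: MochizukiEtTh2009, Def 3.6 p.77] -/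
theorem isMonoprime_of_eq_top {S : Submonoid M} (hS : S = ⊤) : IsMonoprime ↥S := by
  subst hS
  exact IsMonoprime.ofQ ⟨⟨Submonoid.topEquiv⟩⟩

/-- `SingleObj ℕ_{≥1}` is totally epimorphic (`ℕ_{≥1}` is cancellative). [cite: MochizukiFrdI2008, §0 p.15] -/
theorem isTotallyEpimorphic : IsTotallyEpimorphic (SingleObj ℕ+) :=
  ⟨fun f => ⟨fun g h e => by
    have e' : expo g * expo f = expo h * expo f := e
    have e'' : expo g = expo h := mul_right_cancel e'
    exact e''⟩⟩

/-- **Def. 3.6 (ii) AS TYPED, the dilating inhabitant**: `D = D₀ = SingleObj ℕ_{≥1}` (one object — connected,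
totally epimorphic), `Φ = Φ^{ℝ-log} = ℚ_{≥0}` pulled back by CONTRACTIONS (group-saturated trivially;
`Φ^{bs-fld} = ℚ_{≥0}` is `ℚ`-monoprime, REAL), Def. 3.6 (ii)(b) by the constant `1 ∈ (ℚ≥0)^gp` with divisor
`1/0 ≠ 0`; the vocabulary clauses (perf-factorial, divisorial) read `True`. [cite: MochizukiEtTh2009, Def 3.6 p.77] -/
def C : TemperedFrobenioid realified (SingleObj ℕ+) catVocab where
  isConnected := zigzag_isConnected fun _ _ => Relation.ReflTransGen.refl
  isTotallyEpimorphic := isTotallyEpimorphic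
  base := 𝟭 _
  Φ := ⟨fun _ => ⊤, fun _ _ _ => trivial⟩
  isGroupSaturated A := (isGroupSaturated_iff' _).2 fun _ _ _ _ _ _ => trivial
  isPerfFactorial _ := trivial
  isDivisorialOn := trivial
  isMonoprime_bsFld A := isMonoprime_of_eq_top
    (eq_top_iff.2 fun x _ => Submonoid.mem_inf.2 ⟨Submonoid.mem_top x,
      (Subgroup.mem_top (Algebra.GrothendieckGroup.of x) :
        Algebra.GrothendieckGroup.of x ∈ (⊤ : Subgroup (Algebra.GrothendieckGroup M)))⟩)
  exists_FΛ_div_ne A := by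
    refine ⟨Algebra.GrothendieckGroup.of (Multiplicative.ofAdd (1 : ℚ≥0)), trivial,
      Multiplicative.ofAdd (1 : ℚ≥0), trivial, 1, trivial, ?_, ?_⟩
    · intro h
      have h' : (Multiplicative.ofAdd (1 : ℚ≥0) : M) = (1 : M) := h
      have h'' := congrArg Multiplicative.toAdd h'
      simp at h''
    · rw [map_one, div_one]
      rfl

/-! ## §3 The model category of `C`: bookkeeping -/

/-- The one object of the base. [cite: MochizukiEtTh2009, Def 3.6 p.76] -/
abbrev pt : SingleObj ℕ+ := SingleObj.star ℕ+

/-- The arrow `A → B` of the base with exponent `n` (all objects of `SingleObj ℕ_{≥1}` are `•`).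
[cite: MochizukiEtTh2009, Def 3.6 p.76] -/
def arrowAt (A B : SingleObj ℕ+) (n : ℕ+) : A ⟶ B := n

/-- `expo (arrowAt n) = n`. [cite: MochizukiEtTh2009, Def 3.6 p.76] -/
@[simp] theorem expo_arrowAt (A B : SingleObj ℕ+) (n : ℕ+) : expo (arrowAt A B n) = n := rfl

/-- `arrowAt (expo f) = f`. [cite: MochizukiEtTh2009, Def 3.6 p.76] -/
@[simp] theorem arrowAt_expo {A B : SingleObj ℕ+} (f : A ⟶ B) : arrowAt A B (expo f) = f := rfl

/-- Positive naturals are nonzero in `ℚ_{≥0}` (bookkeeping for the scalings of `Φ = ℚ_{≥0}`). [cite: MochizukiEtTh2009, Def 3.6 p.76] -/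
theorem cast_ne_zero (n : ℕ+) : ((n : ℕ) : ℚ≥0) ≠ 0 := Nat.cast_ne_zero.mpr n.ne_zero

/-- `scale c` is injective for `c ≠ 0`. [cite: MochizukiEtTh2009, Def 3.6 p.76] -/
theorem scale_injective {c : ℚ≥0} (hc : c ≠ 0) : Function.Injective (scale c) := fun x y h => by
  have h' := congrArg Multiplicative.toAdd h
  simp only [scale_apply, toAdd_ofAdd] at h'
  exact Multiplicative.toAdd.injective (mul_left_cancel₀ hc h')

/-- The SWAPPED divisor: an arrow of Frobenius degree `n` and base exponent `e` with zero divisor `z` goes to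
`(e/n)·z`. [cite: MochizukiEtTh2009, Def 3.6 p.77] -/
def sdiv (n e : ℕ+) (z : M) : M := scale (((e : ℕ) : ℚ≥0) / ((n : ℕ) : ℚ≥0)) z

/-- `sdiv 1 1 = id`. [cite: MochizukiEtTh2009, Def 3.6 p.77] -/
@[simp] theorem sdiv_one_one (z : M) : sdiv 1 1 z = z := by
  apply Multiplicative.toAdd.injective
  simp [sdiv]

/-- `sdiv n e` and `sdiv e n` are mutually inverse. [cite: MochizukiEtTh2009, Def 3.6 p.77] -/
@[simp] theorem sdiv_sdiv (n e : ℕ+) (z : M) : sdiv n e (sdiv e n z) = z := by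
  apply Multiplicative.toAdd.injective
  simp only [sdiv, scale_apply, toAdd_ofAdd]
  have hn := cast_ne_zero n
  have he := cast_ne_zero e
  field_simp

/-- **The cocycle identity** making the swap a functor: for composable arrows with data `(n₁, e₁, z₁)`,
`(n₂, e₂, z₂)` (composite: degree `n₂n₁`, exponent `e₂e₁`, divisor `z₂/e₁ + n₂·z₁`), the swapped divisor of the
composite is the composite of the swapped divisors (pull-back by `1/n₁`, degree `e₂`).
[cite: MochizukiFrdI2008, Thm. 5.2(i) p.100] -/
theorem sdiv_comp (n₁ e₁ n₂ e₂ : ℕ+) (z₁ z₂ : M) :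
    sdiv (n₂ * n₁) (e₂ * e₁) (scale (((e₁ : ℕ) : ℚ≥0))⁻¹ z₂ * z₁ ^ ((n₂ : ℕ))) =
      scale (((n₁ : ℕ) : ℚ≥0))⁻¹ (sdiv n₂ e₂ z₂) * sdiv n₁ e₁ z₁ ^ ((e₂ : ℕ)) := by
  apply Multiplicative.toAdd.injective
  simp only [sdiv, scale_apply, toAdd_ofAdd, toAdd_mul, toAdd_pow, map_mul, map_pow, PNat.mul_coe,
    Nat.cast_mul, nsmul_eq_mul]
  have h₁ := cast_ne_zero n₁
  have h₂ := cast_ne_zero e₁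
  have h₃ := cast_ne_zero n₂
  have h₄ := cast_ne_zero e₂
  apply NNRat.coe_injective
  push_cast
  field_simp

/-- An element of `Φ(A) = ℚ_{≥0}` (the whole of `Φ^{ℝ-log}(A)`) with given value. [cite: MochizukiEtTh2009, Def 3.6 p.77] -/
def φOf (A : (SingleObj ℕ+)ᵒᵖ) (x : M) : (C.divisorMonoid.obj A : Type) :=
  (⟨x, Submonoid.mem_top x⟩ : ↥(⊤ : Submonoid M))

/-- Value of `φOf`. [cite: MochizukiEtTh2009, Def 3.6 p.77] -/
@[simp] theorem φOf_val (A : (SingleObj ℕ+)ᵒᵖ) (x : M) : (φOf A x).1 = x := rfl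


/-- `φOf` is multiplicative. [cite: MochizukiEtTh2009, Def 3.6 p.77] -/
theorem φOf_mul (A : (SingleObj ℕ+)ᵒᵖ) (x y : M) : φOf A (x * y) = φOf A x * φOf A y := Subtype.ext rfl

/-- `φOf 1 = 1`. [cite: MochizukiEtTh2009, Def 3.6 p.77] -/
@[simp] theorem φOf_one (A : (SingleObj ℕ+)ᵒᵖ) : φOf A 1 = 1 := Subtype.ext rfl

/-- The value in `ℚ_{≥0}` of an element of `Φ(A)` (bookkeeping coercion). [cite: MochizukiEtTh2009, Def 3.6 p.77] -/
def dval {A : (SingleObj ℕ+)ᵒᵖ} (z : (C.divisorMonoid.obj A : Type)) : M := z.1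

/-- `dval ∘ φOf = id`. [cite: MochizukiEtTh2009, Def 3.6 p.77] -/
@[simp] theorem dval_φOf (A : (SingleObj ℕ+)ᵒᵖ) (x : M) : dval (φOf A x) = x := rfl

/-- `φOf ∘ dval = id`. [cite: MochizukiEtTh2009, Def 3.6 p.77] -/
@[simp] theorem φOf_dval (A : (SingleObj ℕ+)ᵒᵖ) (z : (C.divisorMonoid.obj A : Type)) : φOf A (dval z) = z :=
  Subtype.ext rfl

/-- `dval` is injective. [cite: MochizukiEtTh2009, Def 3.6 p.77] -/
theorem dval_injective (A : (SingleObj ℕ+)ᵒᵖ) : Function.Injective (dval (A := A)) :=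
  fun _ _ h => Subtype.ext h

/-- The pull-back of `Φ` along the arrow of exponent `n` is the contraction `z ↦ z/n` (values).
[cite: MochizukiEtTh2009, Def 3.6 p.77] -/
theorem divisorMonoid_map_val {A B : SingleObj ℕ+} (f : A ⟶ B) (z : (C.divisorMonoid.obj (op B) : Type)) :
    dval ((C.divisorMonoid.map f.op).hom z) = scale (((expo f : ℕ) : ℚ≥0))⁻¹ (dval z) := rfl

/-- The ISOMETRIC rational function with divisor class `of z`: the pair `(of z, of z) ∈ B = B₀^Λ ×_{(Φ^{ℝ-log})^gp} Φ^gp`.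
[cite: MochizukiEtTh2009, Def 3.6 p.77] -/
def swapUnit (w : M) : (C.ratFnFunctor.obj (op pt) : Type) :=
  (⟨(Algebra.GrothendieckGroup.of w, Algebra.GrothendieckGroup.of (φOf (op pt) w)), by
    change Algebra.GrothendieckGroup.of w = C.ΦgpToRlog (op pt) (Algebra.GrothendieckGroup.of (φOf (op pt) w))
    change _ = gpMap _ _
    rw [gpMap_of]
    rfl⟩ : ↥(C.ratFn (op pt)))

/-- `Div_B(u) = ξ` for `u = (b, ξ) ∈ B` (bookkeeping). [cite: MochizukiEtTh2009, Def 3.6 p.77] -/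
theorem divB_apply (A : (SingleObj ℕ+)ᵒᵖ) (u : (C.ratFnFunctor.obj A : Type)) :
    divB C.divisorMonoid C.ratFnFunctor C.divBNatTrans A u = u.1.2 := rfl

/-- `swapUnit` is multiplicative. [cite: MochizukiEtTh2009, Def 3.6 p.77] -/
theorem swapUnit_mul (x y : M) : swapUnit (x * y) = swapUnit x * swapUnit y := by
  apply Subtype.ext
  refine Prod.ext ?_ ?_
  · change Algebra.GrothendieckGroup.of (x * y) = Algebra.GrothendieckGroup.of x * Algebra.GrothendieckGroup.of y
    rw [map_mul]
  · change Algebra.GrothendieckGroup.of (φOf (op pt) (x * y)) =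
      Algebra.GrothendieckGroup.of (φOf (op pt) x) * Algebra.GrothendieckGroup.of (φOf (op pt) y)
    rw [φOf_mul, map_mul]

/-- `swapUnit 1 = 1`. [cite: MochizukiEtTh2009, Def 3.6 p.77] -/
@[simp] theorem swapUnit_one : swapUnit 1 = 1 := by
  apply Subtype.ext
  refine Prod.ext ?_ ?_
  · change Algebra.GrothendieckGroup.of (1 : M) = 1
    rw [map_one]
  · change Algebra.GrothendieckGroup.of (φOf (op pt) 1) = 1
    rw [φOf_one, map_one]

/-- `swapUnit` and powers. [cite: MochizukiEtTh2009, Def 3.6 p.77] -/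
theorem swapUnit_pow (x : M) (k : ℕ) : swapUnit (x ^ k) = swapUnit x ^ k := by
  induction k with
  | zero => rw [pow_zero, pow_zero, swapUnit_one]
  | succ k ih => rw [pow_succ, pow_succ, swapUnit_mul, ih]

/-- Pull-back of `swapUnit w` along the arrow of exponent `n`: the rational function of `w/n`.
[cite: MochizukiEtTh2009, Def 3.6 p.77] -/
theorem ratFnFunctor_map_swapUnit (n : ℕ+) (w : M) :
    (C.ratFnFunctor.map (arrowAt pt pt n).op).hom (swapUnit w) = swapUnit (scale (((n : ℕ) : ℚ≥0))⁻¹ w) := by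
  apply Subtype.ext
  rw [show ((C.ratFnFunctor.map (arrowAt pt pt n).op).hom (swapUnit w) : ↥(C.ratFn (op pt))).1 = _ from
    C.coe_ratFnPull _ _]
  refine Prod.ext ?_ ?_
  · change MonGp.map (scale (((expo (arrowAt pt pt n) : ℕ) : ℚ≥0))⁻¹) (Algebra.GrothendieckGroup.of w) =
      Algebra.GrothendieckGroup.of _
    rw [MonGp.map_of]
    rfl
  · change gpMap (C.Φ.pull (arrowAt pt pt n).op) (Algebra.GrothendieckGroup.of (φOf (op pt) w)) =
      Algebra.GrothendieckGroup.of (φOf (op pt) _)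
    rw [gpMap_of]
    rfl
end DilSwap

end Literature.AnabelianGeometry.EtaleTheta

end
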